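import Summits.CriticalPhenomena.PercolationContinuityZ3.Theorems.PercNearOneGluingNoHeavyLowerTailSunflowerForcedReduction
import HarnessLib
import HarnessLib.Audit

/-!
# `NoHeavyLowerTail` (crux stmt-CriticalPhenomena-4575), abstract sunflower cubic: the SATURATION NORMAL FORM of the partition lemma —
# `PartitionLemmaH` holds iff it holds for SATURATED sunflowers (every minimal kernel set lies above petal sets of two colours,
# every maximal bottom set lies below petal sets of two colours)

Support file (seat `prim-ineq-gen-2` gen 19; `--supports stmt-CriticalPhenomena-4575`; companion of `…SunflowerPromotion` (prove-1 g25/26) and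
`…SunflowerForcedReduction`).  Nothing is asserted about the crux; no `sorry`, no named facts.
Memo: run/shared/lean/prim/prim-ineq-gen-2/SATURATION-GEN19.md.

TWO `ZH`-DECREASING MOVES.  For a sunflower `F` (monotone `lab : 2^α → M₃`; `ZH = Σ_{ordered 3-partitions} s6H`):
* `Sunflower.extend` — PETAL EXTENSION: a nonempty BOTTOM set `K` all of whose proper supersets lie in `V i₀` is added to `V i₀` (it becomes a
  minimal petal set of colour `i₀`; the result is again a sunflower because `K` lies in no `V j`).  `Sunflower.ZH_extend_le`: this never
  INCREASES `ZH` — it is the reverse of prove-1's "demotion of a minimal petal set to the bottom" and follows from `demotion_sum_nonneg`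
  (kernel domination `s6H 0 y z − s6H i y z ≥ kk y z` + antipodal Gladkov) by the block bookkeeping of `ZH_le_ZH_promote`.
* `Sunflower.ZH_demote_le` — KERNEL DEMOTION: a nonempty kernel set `K` none of whose proper subsets lies in a `V j`, `j ≠ i₀`, is removed from the
  two other up-sets (prove-1's `Sunflower.demote`); `ZH` does not increase (`ZH_le_ZH_promote` read backwards via `promote_demote_V`).
SATURATION.  `Sunflower.IsSaturated F`: no move of either kind is available.  Equivalently (`IsSaturated.two_colours_below`,
`IsSaturated.two_colours_above`): every nonempty kernel set has proper subsets in two different `V j` (so every minimal kernel set is a union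
`P ∪ Q` of petal sets of two colours — the kernel is FORCED, prove-1's (R1)/(R2) normal form), and every nonempty bottom set `K` has, for each colour
`i`, a proper superset outside `V i` (so every maximal bottom set is an intersection `P ∩ Q` of petal sets of two colours — the bottom is CO-FORCED).
* **`Sunflower.exists_saturated_ZH_le`**: for every sunflower `F` there is a saturated sunflower `G` on the same ground set with `G.ZH ≤ F.ZH`
  (iterate the two moves; the measure `#A + #B` drops at each step).
* **`partitionLemmaH_iff_saturated`**: `PartitionLemmaH ↔ (∀ saturated F, 0 ≤ F.ZH)`.
So the partition lemma (hence, by cloning, the abstract `H_{q+t}` row) lives entirely on sunflowers determined by their three petal families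
(`A = ↑{P ∪ Q}`, `B = ↓{P ∩ Q}`, `P, Q` petal sets of different colours).  Census (memo): of the 1 182 isomorphism classes of sunflowers on 4
points only 30 are saturated (15 with `ZH = 0`; every saturated class with a rainbow partition is an OR-product); the doubled star on 6 points
(`…SunflowerDoubledStar`, `ZH = 42`, Lemma B false) is saturated, so both payers (kernel slack and bottom slack) survive the normal form.
-/

namespace Summit.CriticalPhenomena.PercolationContinuityZ3.Theorems.SunflowerPartition

open Finset

variable {α : Type*} [Fintype α] [DecidableEq α]

/-- The `Fin 5` code of petal colour `i : Fin 3` (`V 0 ↦ 1`, `V 1 ↦ 2`, `V 2 ↦ 3`). [this work] -/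
def petalVal (i : Fin 3) : Fin 5 := ⟨i.val + 1, by omega⟩

/-- `petalVal i` is a petal value. [this work] -/
theorem petalVal_cases (i : Fin 3) : petalVal i = 1 ∨ petalVal i = 2 ∨ petalVal i = 3 := by
  fin_cases i
  · exact Or.inl rfl
  · exact Or.inr (Or.inl rfl)
  · exact Or.inr (Or.inr rfl)

namespace Sunflower

variable (F : Sunflower α)

/-! ## Bottom sets and the value of `lab` -/

omit [Fintype α] in
/-- A set lying in no `V j` is labelled `0`. [this work] -/
theorem lab_eq_zero_of_forall_not_mem {S : Finset α} (h : ∀ j, S ∉ F.V j) : F.lab S = 0 := by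
  have hA : S ∉ F.A := fun hS => h 0 (F.A_subset_V 0 hS)
  unfold lab; rw [if_neg hA, if_neg (h 0), if_neg (h 1), if_neg (h 2)]

/-! ## The petal-extension move (bottom set ↦ minimal petal set) -/

omit [Fintype α] in
/-- Intersections are unchanged when a set outside every `V j` is inserted into one of them. [this work] -/
theorem extend_inter_aux (K : Finset α) (i₀ : Fin 3) (hB : ∀ j, K ∉ F.V j) (i j : Fin 3) (hij : i ≠ j) :
    ((if i = i₀ then insert K (F.V i) else F.V i) ∩ (if j = i₀ then insert K (F.V j) else F.V j)) = F.V i ∩ F.V j := by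
  ext S
  rw [mem_inter, mem_inter]
  by_cases hi : i = i₀
  · have hj : j ≠ i₀ := fun hj => hij (hi.trans hj.symm)
    rw [if_pos hi, if_neg hj, mem_insert]
    constructor
    · rintro ⟨h1 | h1, h2⟩
      · subst h1; exact absurd h2 (hB j)
      · exact ⟨h1, h2⟩
    · rintro ⟨h1, h2⟩; exact ⟨Or.inr h1, h2⟩
  · by_cases hj : j = i₀
    · rw [if_neg hi, if_pos hj, mem_insert]
      constructor
      · rintro ⟨h1, h2 | h2⟩
        · subst h2; exact absurd h1 (hB i)
        · exact ⟨h1, h2⟩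
      · rintro ⟨h1, h2⟩; exact ⟨h1, Or.inr h2⟩
    · rw [if_neg hi, if_neg hj]

omit [Fintype α] in
/-- **Petal extension**: add the bottom set `K` (all of whose proper supersets lie in `V i₀`) to `V i₀`. [this work] -/
def extend (K : Finset α) (i₀ : Fin 3) (hsup : ∀ T : Finset α, K ⊂ T → T ∈ F.V i₀) (hB : ∀ j, K ∉ F.V j) : Sunflower α where
  V := fun i => if i = i₀ then insert K (F.V i) else F.V i
  upper := by
    intro i S T hST hS
    rw [Finset.mem_coe] at hS ⊢
    by_cases hi : i = i₀
    · have hS' : S ∈ insert K (F.V i) := by simpa only [hi, if_true] using hS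
      show T ∈ (if i = i₀ then insert K (F.V i) else F.V i)
      rw [if_pos hi, mem_insert]
      rw [mem_insert] at hS'
      rcases hS' with rfl | hS'
      · by_cases h : T = S
        · exact Or.inl h
        · right
          have hlt : S ⊂ T := lt_of_le_of_ne hST (Ne.symm h)
          rw [hi]; exact hsup T hlt
      · exact Or.inr (F.upper i hST hS')
    · have hS' : S ∈ F.V i := by simpa only [hi, if_false] using hS
      show T ∈ (if i = i₀ then insert K (F.V i) else F.V i)
      rw [if_neg hi]
      exact F.upper i hST hS'
  inter_eq := by
    intro i j hij
    rw [F.extend_inter_aux K i₀ hB i j hij, F.extend_inter_aux K i₀ hB 0 1 (by decide)]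
    exact F.inter_eq i j hij

omit [Fintype α] in
/-- The up-sets of the extended sunflower. [this work] -/
theorem extend_V (K : Finset α) (i₀ : Fin 3) (hsup) (hB) (i : Fin 3) :
    (F.extend K i₀ hsup hB).V i = if i = i₀ then insert K (F.V i) else F.V i := rfl

omit [Fintype α] in
/-- The kernel is unchanged by petal extension. [this work] -/
theorem extend_A (K : Finset α) (i₀ : Fin 3) (hsup) (hB) : (F.extend K i₀ hsup hB).A = F.A := by
  unfold A
  rw [extend_V, extend_V, F.extend_inter_aux K i₀ hB 0 1 (by decide)]

omit [Fintype α] in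
/-- Membership of a set other than `K` is unchanged. [this work] -/
theorem mem_extend_V_of_ne (K : Finset α) (i₀ : Fin 3) (hsup) (hB) {S : Finset α} (hS : S ≠ K) (i : Fin 3) :
    S ∈ (F.extend K i₀ hsup hB).V i ↔ S ∈ F.V i := by
  rw [extend_V]
  by_cases hi : i = i₀
  · rw [if_pos hi, mem_insert]; exact ⟨fun h => h.resolve_left hS, Or.inr⟩
  · rw [if_neg hi]

omit [Fintype α] in
/-- Membership of `K` itself: exactly in `V i₀`. [this work] -/
theorem mem_extend_V_self (K : Finset α) (i₀ : Fin 3) (hsup) (hB) (i : Fin 3) :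
    K ∈ (F.extend K i₀ hsup hB).V i ↔ i = i₀ := by
  rw [extend_V]
  by_cases hi : i = i₀
  · rw [if_pos hi]; simp only [mem_insert, true_or, true_iff]; exact hi
  · rw [if_neg hi]; simp only [hi, iff_false]; exact hB i

omit [Fintype α] in
/-- Labelling after petal extension: `K ↦ petalVal i₀`, everything else unchanged. [this work] -/
theorem lab_extend (K : Finset α) (i₀ : Fin 3) (hsup) (hB) (S : Finset α) :
    (F.extend K i₀ hsup hB).lab S = if S = K then petalVal i₀ else F.lab S := by
  by_cases hS : S = K
  · subst hS
    rw [if_pos rfl]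
    have hA : S ∉ (F.extend S i₀ hsup hB).A := by rw [extend_A]; exact fun h => hB 0 (F.A_subset_V 0 h)
    have hV := F.mem_extend_V_self S i₀ hsup hB
    unfold lab
    rw [if_neg hA]
    fin_cases i₀
    · rw [if_pos ((hV 0).2 rfl)]; rfl
    · rw [if_neg (fun h => absurd ((hV 0).1 h) (by decide)), if_pos ((hV 1).2 rfl)]; rfl
    · rw [if_neg (fun h => absurd ((hV 0).1 h) (by decide)), if_neg (fun h => absurd ((hV 1).1 h) (by decide)),
        if_pos ((hV 2).2 rfl)]; rfl
  · rw [if_neg hS]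
    have hA : (S ∈ (F.extend K i₀ hsup hB).A) ↔ S ∈ F.A := by rw [extend_A]
    have hV := fun i => F.mem_extend_V_of_ne K i₀ hsup hB hS i
    unfold lab
    simp only [hA, hV]

/-- The pointwise change of the summand under petal extension, split by which block equals `K`. [this work] -/
theorem extend_summand (K : Finset α) (i₀ : Fin 3) (hsup) (hB) (hK : K.Nonempty) {S T : Finset α} (hd : Disjoint S T) :
    s6H ((F.extend K i₀ hsup hB).lab S) ((F.extend K i₀ hsup hB).lab T) ((F.extend K i₀ hsup hB).lab (S ∪ T)ᶜ)
      - s6H (F.lab S) (F.lab T) (F.lab (S ∪ T)ᶜ)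
      = (if S = K then s6H (petalVal i₀) (F.lab T) (F.lab (S ∪ T)ᶜ) - s6H (F.lab K) (F.lab T) (F.lab (S ∪ T)ᶜ) else 0)
        + (if T = K then s6H (F.lab S) (petalVal i₀) (F.lab (S ∪ T)ᶜ) - s6H (F.lab S) (F.lab K) (F.lab (S ∪ T)ᶜ) else 0)
        + (if (S ∪ T)ᶜ = K then s6H (F.lab S) (F.lab T) (petalVal i₀) - s6H (F.lab S) (F.lab T) (F.lab K) else 0) := by
  rw [lab_extend, lab_extend, lab_extend]
  by_cases h1 : S = K
  · have h2 : T ≠ K := snd_ne_of_fst_eq hK hd h1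
    have h3 : (S ∪ T)ᶜ ≠ K := compl_ne_of_fst_eq hK h1
    rw [if_pos h1, if_neg h2, if_neg h3, if_pos h1, if_neg h2, if_neg h3, h1]; ring
  by_cases h2 : T = K
  · have h3 : (S ∪ T)ᶜ ≠ K := compl_ne_of_snd_eq hK h2
    rw [if_neg h1, if_pos h2, if_neg h3, if_neg h1, if_pos h2, if_neg h3, h2]; ring
  by_cases h3 : (S ∪ T)ᶜ = K
  · rw [if_neg h1, if_neg h2, if_pos h3, if_neg h1, if_neg h2, if_pos h3, h3]; ring
  · rw [if_neg h1, if_neg h2, if_neg h3, if_neg h1, if_neg h2, if_neg h3]; ring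

/-- **PETAL EXTENSION NEVER INCREASES `ZH`** (this work): if `K` is a nonempty bottom set all of whose proper supersets lie in `V i₀`, then
`(F.extend K i₀).ZH ≤ F.ZH` (three applications of `demotion_sum_nonneg`, one per block equal to `K`). [this work] -/
theorem ZH_extend_le (K : Finset α) (i₀ : Fin 3) (hsup : ∀ T : Finset α, K ⊂ T → T ∈ F.V i₀) (hB : ∀ j, K ∉ F.V j)
    (hK : K.Nonempty) : (F.extend K i₀ hsup hB).ZH ≤ F.ZH := by
  rw [← sub_nonpos]
  unfold ZH
  rw [← sum_sub_distrib]
  have hq : ∀ q ∈ parts α, Disjoint q.1 q.2 := fun q hq => (mem_filter.1 hq).2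
  rw [sum_congr rfl fun q hqq => F.extend_summand K i₀ hsup hB hK (hq q hqq)]
  rw [sum_add_distrib, sum_add_distrib]
  rw [sum_parts_fst_eq K (fun T R => s6H (petalVal i₀) (F.lab T) (F.lab R) - s6H (F.lab K) (F.lab T) (F.lab R)),
    sum_parts_snd_eq K (fun S R => s6H (F.lab S) (petalVal i₀) (F.lab R) - s6H (F.lab S) (F.lab K) (F.lab R)),
    sum_parts_thd_eq K (fun S T => s6H (F.lab S) (F.lab T) (petalVal i₀) - s6H (F.lab S) (F.lab T) (F.lab K))]
  have hK0 : F.lab K = 0 := F.lab_eq_zero_of_forall_not_mem hB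
  rw [hK0]
  have e1 : ∀ T ∈ (Kᶜ).powerset, (K ∪ T)ᶜ = Kᶜ \ T := fun T _ => by rw [compl_union, sdiff_eq_inter_compl]
  have e2 : ∀ S ∈ (Kᶜ).powerset, (S ∪ K)ᶜ = Kᶜ \ S := fun S _ => by
    rw [compl_union, sdiff_eq_inter_compl, inter_comm]
  have s1 := F.demotion_sum_nonneg (petalVal i₀) (petalVal_cases i₀) Kᶜ
  have s1' : ∑ T ∈ (Kᶜ).powerset, (s6H (petalVal i₀) (F.lab T) (F.lab (K ∪ T)ᶜ) - s6H 0 (F.lab T) (F.lab (K ∪ T)ᶜ)) ≤ 0 := by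
    have : ∑ T ∈ (Kᶜ).powerset, (s6H (petalVal i₀) (F.lab T) (F.lab (K ∪ T)ᶜ) - s6H 0 (F.lab T) (F.lab (K ∪ T)ᶜ))
        = -∑ T ∈ (Kᶜ).powerset, (s6H 0 (F.lab T) (F.lab (Kᶜ \ T)) - s6H (petalVal i₀) (F.lab T) (F.lab (Kᶜ \ T))) := by
      rw [← sum_neg_distrib]; refine sum_congr rfl fun T hT => ?_; rw [e1 T hT]; ring
    rw [this]; linarith
  have s2' : ∑ S ∈ (Kᶜ).powerset, (s6H (F.lab S) (petalVal i₀) (F.lab (S ∪ K)ᶜ) - s6H (F.lab S) 0 (F.lab (S ∪ K)ᶜ)) ≤ 0 := by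
    have : ∑ S ∈ (Kᶜ).powerset, (s6H (F.lab S) (petalVal i₀) (F.lab (S ∪ K)ᶜ) - s6H (F.lab S) 0 (F.lab (S ∪ K)ᶜ))
        = -∑ S ∈ (Kᶜ).powerset, (s6H 0 (F.lab S) (F.lab (Kᶜ \ S)) - s6H (petalVal i₀) (F.lab S) (F.lab (Kᶜ \ S))) := by
      rw [← sum_neg_distrib]; refine sum_congr rfl fun S hS => ?_
      rw [e2 S hS, (s6H_symm (petalVal i₀) (F.lab S) _).1, (s6H_symm 0 (F.lab S) _).1]; ring
    rw [this]; linarith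
  have s3' : ∑ S ∈ (Kᶜ).powerset, (s6H (F.lab S) (F.lab (Kᶜ \ S)) (petalVal i₀) - s6H (F.lab S) (F.lab (Kᶜ \ S)) 0) ≤ 0 := by
    have c1 : ∀ a b c : Fin 5, s6H a b c = s6H b c a := by decide
    have : ∑ S ∈ (Kᶜ).powerset, (s6H (F.lab S) (F.lab (Kᶜ \ S)) (petalVal i₀) - s6H (F.lab S) (F.lab (Kᶜ \ S)) 0)
        = -∑ S ∈ (Kᶜ).powerset, (s6H 0 (F.lab S) (F.lab (Kᶜ \ S)) - s6H (petalVal i₀) (F.lab S) (F.lab (Kᶜ \ S))) := by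
      rw [← sum_neg_distrib]; refine sum_congr rfl fun S _ => ?_
      rw [← c1 (petalVal i₀), ← c1 0]; ring
    rw [this]; linarith
  linarith

/-! ## The kernel-demotion move decreases `ZH` -/

omit [Fintype α] in
/-- Legality of demoting a kernel set none of whose proper subsets lies in a foreign up-set. [this work] -/
theorem demote_legal (K : Finset α) (i₀ : Fin 3) (hlow : ∀ S : Finset α, S ⊂ K → ∀ j, j ≠ i₀ → S ∉ F.V j) :
    ∀ i, i ≠ i₀ → ∀ S ∈ F.V i, S ≠ K → ∀ T, S ⊆ T → T ≠ K := by
  intro i hi S hS hSK T hST hTK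
  subst hTK
  exact hlow S (lt_of_le_of_ne hST hSK) i hi hS

/-- **KERNEL DEMOTION NEVER INCREASES `ZH`** (this work; = prove-1's `ZH_le_ZH_promote` read backwards): if `K` is a nonempty kernel set and no proper
subset of `K` lies in `V j` for `j ≠ i₀`, then removing `K` from the two up-sets `V j`, `j ≠ i₀`, gives a sunflower with `ZH ≤ F.ZH`. [this work] -/
theorem ZH_demote_le (K : Finset α) (i₀ : Fin 3) (hKA : K ∈ F.A) (hK : K.Nonempty)
    (hlow : ∀ S : Finset α, S ⊂ K → ∀ j, j ≠ i₀ → S ∉ F.V j) :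
    (F.demote K i₀ (F.demote_legal K i₀ hlow)).ZH ≤ F.ZH := by
  set G := F.demote K i₀ (F.demote_legal K i₀ hlow) with hG
  have hGA : G.A = (F.A).erase K := F.demote_A K i₀ _
  have hKV : ∀ i, K ∈ F.V i := fun i => F.A_subset_V i hKA
  have hGlab : G.lab K = 1 ∨ G.lab K = 2 ∨ G.lab K = 3 := by
    have hKGA : K ∉ G.A := by rw [hGA]; exact Finset.notMem_erase K F.A
    have hGV : ∀ i, (K ∈ G.V i ↔ i = i₀) := by
      intro i; show (K ∈ (if i = i₀ then F.V i else (F.V i).erase K)) ↔ _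
      by_cases hi : i = i₀
      · simp only [hi, if_true, iff_true]; exact hKV i₀
      · simp only [hi, if_false, mem_erase, ne_eq, not_true_eq_false, false_and]
    unfold lab
    rw [if_neg hKGA]
    fin_cases i₀
    · left; rw [if_pos ((hGV 0).2 rfl)]
    · right; left; rw [if_neg (fun h => by have := (hGV 0).1 h; exact absurd this (by decide)), if_pos ((hGV 1).2 rfl)]
    · right; right
      rw [if_neg (fun h => by have := (hGV 0).1 h; exact absurd this (by decide)),
        if_neg (fun h => by have := (hGV 1).1 h; exact absurd this (by decide)), if_pos ((hGV 2).2 rfl)]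
  have hsup : ∀ T : Finset α, K ⊂ T → T ∈ G.A := by
    intro T hKT
    rw [hGA, mem_erase]
    exact ⟨(ne_of_lt hKT).symm, F.mem_A_of_subset hKT.le hKA⟩
  have hprom : G.ZH ≤ (G.promote K hsup).ZH := G.ZH_le_ZH_promote K hsup hK hGlab
  have hback : (G.promote K hsup).ZH = F.ZH := ZH_congr (F.promote_demote_V K i₀ _ hKV hsup)
  linarith

/-! ## Saturation -/

/-- A kernel-demotion move is available at `(K, i)`. [this work] -/
def IsKernelMovable (K : Finset α) (i : Fin 3) : Prop :=
  K ∈ F.A ∧ K.Nonempty ∧ ∀ S : Finset α, S ⊂ K → ∀ j, j ≠ i → S ∉ F.V j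

/-- A petal-extension move is available at `(K, i)`. [this work] -/
def IsBottomMovable (K : Finset α) (i : Fin 3) : Prop :=
  K.Nonempty ∧ (∀ j, K ∉ F.V j) ∧ ∀ T : Finset α, K ⊂ T → T ∈ F.V i

/-- **Saturated sunflower**: neither move is available anywhere. [this work] -/
def IsSaturated : Prop :=
  (∀ (K : Finset α) (i : Fin 3), ¬ F.IsKernelMovable K i) ∧ (∀ (K : Finset α) (i : Fin 3), ¬ F.IsBottomMovable K i)

omit [Fintype α] in
/-- In a saturated sunflower every nonempty kernel set has, for each colour `i`, a proper subset in an up-set of another colour; in particular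
every MINIMAL kernel set is a union of petal sets of two different colours (the kernel is forced). [this work] -/
theorem IsSaturated.two_colours_below (h : F.IsSaturated) {K : Finset α} (hKA : K ∈ F.A) (hK : K.Nonempty) (i : Fin 3) :
    ∃ S : Finset α, S ⊂ K ∧ ∃ j, j ≠ i ∧ S ∈ F.V j := by
  by_contra hc
  apply h.1 K i
  refine ⟨hKA, hK, fun S hS j hj hSj => hc ⟨S, hS, j, hj, hSj⟩⟩

omit [Fintype α] in
/-- In a saturated sunflower every nonempty bottom set has, for each colour `i`, a proper superset outside `V i`; in particular every MAXIMAL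
bottom set is an intersection of petal sets of two different colours (the bottom is co-forced). [this work] -/
theorem IsSaturated.two_colours_above (h : F.IsSaturated) {K : Finset α} (hKB : ∀ j, K ∉ F.V j) (hK : K.Nonempty) (i : Fin 3) :
    ∃ T : Finset α, K ⊂ T ∧ T ∉ F.V i := by
  by_contra hc
  exact h.2 K i ⟨hK, hKB, fun T hT => by_contra fun hT' => hc ⟨T, hT, hT'⟩⟩

/-- The saturation measure `#A + #B`. [this work] -/
def satMeasure : ℕ := #F.A + #(univ.filter fun S : Finset α => ∀ j, S ∉ F.V j)

/-- Petal extension lowers the measure by one. [this work] -/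
theorem satMeasure_extend (K : Finset α) (i₀ : Fin 3) (hsup) (hB : ∀ j, K ∉ F.V j) :
    (F.extend K i₀ hsup hB).satMeasure + 1 = F.satMeasure := by
  unfold satMeasure
  rw [extend_A]
  have hfilt : (univ.filter fun S : Finset α => ∀ j, S ∉ (F.extend K i₀ hsup hB).V j)
      = (univ.filter fun S : Finset α => ∀ j, S ∉ F.V j).erase K := by
    ext S
    simp only [mem_filter, mem_univ, true_and, mem_erase]
    constructor
    · intro hS
      have hSK : S ≠ K := by
        rintro rfl
        exact hS i₀ ((F.mem_extend_V_self S i₀ hsup hB i₀).2 rfl)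
      exact ⟨hSK, fun j hj => hS j ((F.mem_extend_V_of_ne K i₀ hsup hB hSK j).2 hj)⟩
    · rintro ⟨hSK, hS⟩ j hj
      exact hS j ((F.mem_extend_V_of_ne K i₀ hsup hB hSK j).1 hj)
  rw [hfilt]
  have hKmem : K ∈ (univ.filter fun S : Finset α => ∀ j, S ∉ F.V j) := by
    simp only [mem_filter, mem_univ, true_and]; exact hB
  rw [card_erase_of_mem hKmem]
  have := card_pos.2 ⟨K, hKmem⟩
  omega

/-- Kernel demotion lowers the measure by one. [this work] -/
theorem satMeasure_demote (K : Finset α) (i₀ : Fin 3) (hKA : K ∈ F.A)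
    (hlow : ∀ S : Finset α, S ⊂ K → ∀ j, j ≠ i₀ → S ∉ F.V j) :
    (F.demote K i₀ (F.demote_legal K i₀ hlow)).satMeasure + 1 = F.satMeasure := by
  unfold satMeasure
  rw [F.demote_A K i₀ _]
  have hKV : ∀ i, K ∈ F.V i := fun i => F.A_subset_V i hKA
  have hfilt : (univ.filter fun S : Finset α => ∀ j, S ∉ (F.demote K i₀ (F.demote_legal K i₀ hlow)).V j)
      = (univ.filter fun S : Finset α => ∀ j, S ∉ F.V j) := by
    ext S
    simp only [mem_filter, mem_univ, true_and]
    have hV : ∀ j, S ∈ (F.demote K i₀ (F.demote_legal K i₀ hlow)).V j ↔ S ∈ (if j = i₀ then F.V j else (F.V j).erase K) :=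
      fun j => Iff.rfl
    constructor
    · intro hS j hj
      by_cases hSK : S = K
      · subst hSK
        apply hS i₀
        rw [hV, if_pos rfl]; exact hKV i₀
      · apply hS j
        rw [hV]
        by_cases hji : j = i₀
        · rw [if_pos hji]; exact hj
        · rw [if_neg hji, mem_erase]; exact ⟨hSK, hj⟩
    · intro hS j hj
      apply hS j
      rw [hV] at hj
      by_cases hji : j = i₀
      · rw [if_pos hji] at hj; exact hj
      · rw [if_neg hji, mem_erase] at hj; exact hj.2
  rw [hfilt, card_erase_of_mem hKA]
  have := card_pos.2 ⟨K, hKA⟩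
  omega

/-- **Every sunflower can be saturated without increasing `ZH`.** [this work] -/
theorem exists_saturated_ZH_le_aux : ∀ (n : ℕ) (F : Sunflower α), F.satMeasure = n → ∃ G : Sunflower α, G.IsSaturated ∧ G.ZH ≤ F.ZH := by
  intro n
  induction n using Nat.strong_induction_on with
  | _ n ih =>
    intro F hn
    by_cases hsat : F.IsSaturated
    · exact ⟨F, hsat, le_rfl⟩
    unfold IsSaturated at hsat
    rw [not_and_or] at hsat
    rcases hsat with h | h
    · -- a kernel-demotion move is available
      push Not at h
      obtain ⟨K, i₀, hKA, hK, hlow⟩ := h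
      set G := F.demote K i₀ (F.demote_legal K i₀ hlow)
      have hm : G.satMeasure + 1 = n := by rw [← hn]; exact F.satMeasure_demote K i₀ hKA hlow
      obtain ⟨G', hG', hZ⟩ := ih G.satMeasure (by omega) G rfl
      exact ⟨G', hG', hZ.trans (F.ZH_demote_le K i₀ hKA hK hlow)⟩
    · -- a petal-extension move is available
      push Not at h
      obtain ⟨K, i₀, hK, hB, hsup⟩ := h
      set G := F.extend K i₀ hsup hB
      have hm : G.satMeasure + 1 = n := by rw [← hn]; exact F.satMeasure_extend K i₀ hsup hB
      obtain ⟨G', hG', hZ⟩ := ih G.satMeasure (by omega) G rfl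
      exact ⟨G', hG', hZ.trans (F.ZH_extend_le K i₀ hsup hB hK)⟩

/-- **Saturation without increasing `ZH`**: for every sunflower there is a saturated one on the same ground set with no larger `ZH`. [this work] -/
theorem exists_saturated_ZH_le : ∃ G : Sunflower α, G.IsSaturated ∧ G.ZH ≤ F.ZH :=
  exists_saturated_ZH_le_aux _ F rfl

end Sunflower

/-- **SATURATION NORMAL FORM** (this work): the partition lemma is equivalent to its restriction to SATURATED sunflowers (forced kernel and
co-forced bottom). [this work] -/
theorem partitionLemmaH_iff_saturated :
    PartitionLemmaH ↔ ∀ (α : Type) [Fintype α] [DecidableEq α] (F : Sunflower α), F.IsSaturated → 0 ≤ F.ZH := by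
  refine ⟨fun h α _ _ F _ => h α F, fun h α _ _ F => ?_⟩
  obtain ⟨G, hG, hZ⟩ := F.exists_saturated_ZH_le
  exact (h α G hG).trans hZ

end Summit.CriticalPhenomena.PercolationContinuityZ3.Theorems.SunflowerPartition
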